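/-
Copyright: statement-level skeleton of a published paper (lit-balaban cell, Phase-2 proof seat p39 gen 18). No proof claims
beyond what the kernel checks below.
-/
import Literature.MathematicalPhysics.QuantumFieldTheory.Balaban1983to89.B3Eq334ZeroLattice
import Literature.MathematicalPhysics.QuantumFieldTheory.Balaban1983to89.B3Ineq314ZeroLattice

/-!
# Bałaban, *(Higgs)₂,₃ quantum fields in a finite volume. III*, CMP 88 (1983): the p. 444 paragraph on (3.34)/(3.36) FOR THE PIECES
# OF THE PRINT'S OWN §3 PROPAGATOR `G_k(0) = G_k(ηℤ^{d+1}, 0)` — the kernel hypotheses of `B3Eq334ZeroLattice` DISCHARGED for triangle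
# kernels built from the (2.6)-pieces, the volume sums on the infinite lattice, and the resummation at `Σ_{j<n} G^η_{(j)}(0)`

[cite: Balaban1983Higgs3, (3.34) p.443 (PDF 33); (3.36) p.444 (PDF 34); (2.10) p.426 (PDF 16); (2.15) p.427 (PDF 17)].  Unit
`lit-balaban-p39-g18` (Phase-2 proof seat p39, gen 18), FILE 2 of the (3.33)–(3.36) lattice chain; fold row `B3.Eq3.33-3.38` (owner r15).
statement-level skeleton of published theorems with citation tags; proofs where landed; nothing here is a claim about the Yang–Mills
mass gap.
v1.1 (p39 gen 22, 2026-08-23; DOC-ONLY, declarations byte-identical to v1.0 p351493; summit-lit1 g87 CITELOC #23 key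
P87-002 + referee ref-1 g79 record-only note): (3.34) is printed on p. 443 [PDF 33], the «convergent expression» sentence on
p. 444 [PDF 34]; the two tags of v1.0 that attached (3.34) to page 444 (docstrings of `abs_convergent334Z_le_norm`,
`abs_convergent334Z_le_zeroLattice`) now read «(3.34) p.443; p.444».  The p. 444 quotes restore the printed η superscripts:
«propagators G^η_{j₀}(0), G^η_{j₀}» (render p034 read).  Nothing else changed.

PDF held: `paper:balaban1983-higgs-2-3-quantum-fields-finite-volume` (journal page = PDF page + 410); pp. 443–444 read in the OCR text and
on the ×2 render `run/shared/lean/pub/pub-balaban/b2b-balaban-ref1/pages/1983-cmp88-higgs23-III/1983-cmp88-higgs23-III-p033-x2.png`.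

THE PRINTED TEXT (verbatim, p. 444): *"This gives us a convergent expression plus the expression [(3.36)] … Next we sum the expressions
(3.36) over admissible orderings and indices and we get the expressions of the same type but with propagators G^η_{j₀}(0), G^η_{j₀}, where
j₀ is the lowest index of the external legs."*; p. 433: *"with the scalar field propagator equal to G_k(0)"*; p. 434: *"We apply the
decomposition (2.6) to the propagators G_k(0), G_k"*; p. 427: *"we use it [the exponential factor] to make the summation over Δ(v′). We
get some constant O(1) depending on δ₁ and n̄ only"*.

CITATION HEADER (lean-in-tree rule).  FILE 1 = `B3Eq334ZeroLattice` ((3.33)/(3.34)/(3.36) with bodies on `ηℤ^{d+1}`, `eq334Z`, the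
*"convergent expression"* bounds `abs_convergent334Z_le` / `abs_local334Z_moveRemZ_le` under a two-scale tree bound of the kernel, the
resummation `local336Z_resum` / `local336Z_triKernelZ_resum`, `norm_triKernelZ_le`).  THIS FILE consumes BY NAME p26 g34's
`B3Ineq314ZeroLattice` (the pieces `gpieceZ ℓ k j a m² = G^η_{(j)}(0)` of `G_k(ηℤ^{d+1},0)`, `etaZ`, `scaleZ`, `GresumZ`, `abs_gpieceZ_le`,
`sum_gpieceZ_range`) and `B3Ineq211ZeroLattice.ineq210_zeroLatticeH` (= (2.10) for these pieces, p26 g34 `B3Ineq210ZeroLattice`).  It is the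
`ℤ^{d+1}` twin of p20 g3's torus `B3AlphaGainSummed` (`sum_vol_exp_le`, `sum_majorant3_le`, `abs_convergent334_le_norm`; the elementary
exponential sums of p20 g2's `B3TorusRadialSums.sum_exp_neg_tdist_le` are re-proved here for finite subsets of `ℤ^{d+1}`, where the bound
is uniform in the subset — the infinite-lattice content).  Nothing of another seat is modified.

WHAT IS PROVED (kind «model-instance»; every theorem proved).
* §1 VOLUME SUMS ON THE INFINITE LATTICE, uniform in the finite localization set: `sum_exp_neg_dist₁_le`
  (`Σ_{x∈Λ} e^{−a|y−x|₁} ≤ (2(1 + a⁻¹))^{d+1}` for every finite `Λ ⊂ ℤ^{d+1}`), `sum_vol_exp_le` (`Σ_{x∈Λ} η^{d+1}e^{−½δη|y−x|₁/s} ≤ (2 + 4/δ)^{d+1}s^{d+1}`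
  for `0 < η ≤ s`), the three-point majorant summed `sum_majorant3Z_le`, and the NORM FORMS of FILE 1's two estimates:
  **`abs_convergent334Z_le_norm`**, **`abs_local334Z_moveRemZ_le_norm`** — the two transported terms of (3.34) and the remainder of the
  move of the localization functions are bounded by `const·(gains)·s₁^{d+1}s₂^{d+1}·Σ_{x′∈Λ′}η^{d+1}‖φ′(x′)‖(‖φ″(x′)‖)` UNIFORMLY IN `Λ, Λ″`
  (the sums over `x, x″` may run over arbitrarily large finite parts of the lattice: *"convergent"*).
* §2 THE KERNEL HYPOTHESIS DISCHARGED for the triangle kernels `Γ′ = triKernelZ T (G^η_{(j₁)}(0)) (G^η_{(j₂)}(0)) (G^η_{(j₃)}(0))` of the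
  pieces of `G_k(ηℤ^{d+1}, 0)` (lines `x–x′`, `x′–x″`, `x–x″`; `‖T_μv‖ ≤ Q‖v‖`): `norm_triKernelZ_gpieceZ_le` (the two-scale tree bound
  with `K = QC³(L^{j₁}η)^{2−(d+1)}(L^{j₂}η)^{2−(d+1)}(L^{j₃}η)^{2−(d+1)}`, rate `δ₁/(d+1)`), **`abs_convergent334Z_le_zeroLattice`** and
  **`abs_local334Z_moveRemZ_le_zeroLattice`** (FILE 1's bounds with NO kernel hypothesis, constants uniform in `k ≥ 1`, the window and the
  indices).
* §3 THE RESUMMATION AT THE PIECES: **`local336Z_triKernelZ_resum_zeroLattice`** — `Σ_{j₁,j₂,j₃<n} (3.36)[G^η_{(j₁)}(0),G^η_{(j₂)}(0),G^η_{(j₃)}(0)]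
  = (3.36)[𝒢_n,𝒢_n,𝒢_n]`, `𝒢_n = Σ_{j<n}G^η_{(j)}(0) = GresumZ n` (`1 ≤ n ≤ k`; p26's `sum_gpieceZ_range`; `𝒢_k = G_k(0)`), i.e. *"the
  expressions of the same type but with propagators G^η_{j₀}(0), G^η_{j₀}"*.

HONEST SCOPE / DECLARED DIVERGENCES (F7).  (i) ZERO FIELD, `Ω = ηℤ^{d+1}`; in §2/§3 ALL THREE lines are instantiated with the zero-field
scalar pieces `G^η_{(j)}(0)` with one common window point `(a, m²)` (the vector-field piece at `A = 0` has the same kernel shape — the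
convention of the torus files of record and of p40's/p39's lattice files); independent window points per line would only change
constants.  (ii) `|x − x′| = η|x − x′|₁`; rate `δ₁/(d+1)` from the `|·|_∞ → |·|₁` conversion of p26's `abs_gpieceZ_le`.  (iii) The Hölder /
sup bounds of the LEGS (`gA`, `φ″`, the localization functions) stay hypotheses (rows B3.Eq2.11, p. 420).  (iv) The admissibility
bookkeeping of orderings (row B3.Eq2.7) is not re-derived (index sums over `[0,n)³`).  (v) NOT treated: the pictures (3.35), the
vanishing/replacement sentences after (3.36) (r15 `B3Sect3TriangleGraphs` §2; p39 g10 `B3Eq337ZeroLattice`/`B3Eq338ZeroLattice` on `ξℤ³`),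
`d = 2`-specific statements.  Theorems only (no definitions); no Literature fact minted, no `sorry`; standard axioms.  Value = the p. 444
paragraph hypothesis-free on the printed carrier, NOT summit progress.  HOME `run/shared/lean/pub/lit-balaban/` (row B3.Eq3.33-3.38,
FILED.md, STATUS.md), 2026-08-23.
-/

open scoped BigOperators RealInnerProductSpace

namespace Literature.MathematicalPhysics.QuantumFieldTheory.Balaban1983to89.B3Eq334ZeroLatticePieces

open B3Taylor310Lattice (dist₁ dist₁_comm dist₁_self natAbs_sub_le_dist₁)
open B3Ineq313Lattice (KernelZ)
open B3Ineq314ZeroLattice (etaZ scaleZ gpieceZ GresumZ etaZ_pos scaleZ_pos abs_gpieceZ_le sum_gpieceZ_range)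
open B3Ineq211ZeroLattice (zeroLatticeKernelsH ineq210_zeroLatticeH)
open B3Eq334ZeroLattice

noncomputable section

variable {d : ℕ}

/-! ## §1 Volume sums on the infinite lattice, uniform in the localization set -/

section VolumeSums

/-- kernel: `(1 − e^{−a})⁻¹ ≤ 1 + a⁻¹` for `a > 0` (from `1 + a ≤ e^a`). [folklore] -/
private theorem inv_one_sub_exp_neg_le {a : ℝ} (ha : 0 < a) : (1 - Real.exp (-a))⁻¹ ≤ 1 + a⁻¹ := by
  have h1 : a + 1 ≤ Real.exp a := Real.add_one_le_exp a
  have h2 : Real.exp (-a) * Real.exp a = 1 := by rw [← Real.exp_add, neg_add_cancel, Real.exp_zero]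
  have h3 : 0 < Real.exp (-a) := Real.exp_pos _
  have h4 : Real.exp (-a) < 1 := by rw [Real.exp_lt_one_iff]; linarith
  have h5 : 0 < 1 - Real.exp (-a) := by linarith
  rw [inv_le_comm₀ h5 (by positivity)]
  have h6 : (1 + a⁻¹)⁻¹ = a / (a + 1) := by field_simp
  rw [h6, div_le_iff₀ (by linarith)]
  nlinarith [mul_le_mul_of_nonneg_left h1 h3.le]

/-- kernel: the one-dimensional exponential sum over any finite set of integers, centred anywhere:
`Σ_{m∈S} e^{−a|m − c|} ≤ 2(1 + a⁻¹)` (`a > 0`), uniformly in `S`. [cite: Balaban1983Higgs3, (2.15) p.427] -/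
theorem sum_exp_neg_abs_sub_le {a : ℝ} (ha : 0 < a) (c : ℤ) (S : Finset ℤ) :
    ∑ m ∈ S, Real.exp (-(a * |((m - c : ℤ) : ℝ)|)) ≤ 2 * (1 + a⁻¹) := by
  classical
  set f : ℤ → ℝ := fun m => Real.exp (-(a * |((m - c : ℤ) : ℝ)|)) with hf
  have hf0 : ∀ m, 0 ≤ f m := fun m => (Real.exp_pos _).le
  set r : ℝ := Real.exp (-a) with hr
  have hr0 : 0 ≤ r := (Real.exp_pos _).le
  have hr1 : r < 1 := by rw [hr, Real.exp_lt_one_iff]; linarith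
  -- a bound on the distance of the elements of `S` from `c`
  set N : ℕ := S.sup (fun m => (m - c).natAbs) + 1 with hN
  have hmem : ∀ m ∈ S, (m - c).natAbs < N := fun m hm =>
    Nat.lt_succ_of_le (Finset.le_sup (f := fun m => (m - c).natAbs) hm)
  -- the geometric sum
  have hgeom : ∑ i ∈ Finset.range N, r ^ i ≤ (1 - r)⁻¹ := by
    have h := geom_sum_Ico_le_of_lt_one hr0 hr1 (m := 0) (n := N)
    rw [pow_zero, ← Finset.range_eq_Ico, one_div] at h
    exact h
  have hval : ∀ i : ℕ, f (c + i) = r ^ i ∧ f (c - i) = r ^ i := by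
    intro i
    have h1 : ((c + i - c : ℤ) : ℝ) = i := by push_cast; ring
    have h2 : ((c - i - c : ℤ) : ℝ) = -i := by push_cast; ring
    refine ⟨?_, ?_⟩
    · simp only [hf, h1, Nat.abs_cast, hr, ← Real.exp_nat_mul]; ring_nf
    · simp only [hf, h2, abs_neg, Nat.abs_cast, hr, ← Real.exp_nat_mul]; ring_nf
  -- the two halves of `S`
  set S₁ := S.filter (fun m => c ≤ m) with hS₁
  set S₂ := S.filter (fun m => ¬ c ≤ m) with hS₂
  have h1 : ∑ m ∈ S₁, f m ≤ ∑ i ∈ Finset.range N, r ^ i := by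
    have hsub : S₁ ⊆ (Finset.range N).image (fun i : ℕ => c + i) := by
      intro m hm
      rw [hS₁, Finset.mem_filter] at hm
      refine Finset.mem_image.2 ⟨(m - c).natAbs, Finset.mem_range.2 (hmem m hm.1), ?_⟩
      have : ((m - c).natAbs : ℤ) = m - c := Int.natAbs_of_nonneg (by omega)
      omega
    have hinj : Set.InjOn (fun i : ℕ => c + (i : ℤ)) (Finset.range N : Set ℕ) := by
      intro i _ i' _ h
      have : (i : ℤ) = i' := by simpa using h
      exact_mod_cast this
    calc ∑ m ∈ S₁, f m ≤ ∑ m ∈ (Finset.range N).image (fun i : ℕ => c + i), f m :=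
          Finset.sum_le_sum_of_subset_of_nonneg hsub fun m _ _ => hf0 m
      _ = ∑ i ∈ Finset.range N, f (c + i) := Finset.sum_image hinj
      _ = ∑ i ∈ Finset.range N, r ^ i := Finset.sum_congr rfl fun i _ => (hval i).1
  have h2 : ∑ m ∈ S₂, f m ≤ ∑ i ∈ Finset.range N, r ^ i := by
    have hsub : S₂ ⊆ (Finset.range N).image (fun i : ℕ => c - i) := by
      intro m hm
      rw [hS₂, Finset.mem_filter] at hm
      refine Finset.mem_image.2 ⟨(m - c).natAbs, Finset.mem_range.2 (hmem m hm.1), ?_⟩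
      have : ((m - c).natAbs : ℤ) = -(m - c) := Int.ofNat_natAbs_of_nonpos (by omega)
      omega
    have hinj : Set.InjOn (fun i : ℕ => c - (i : ℤ)) (Finset.range N : Set ℕ) := by
      intro i _ i' _ h
      have : (i : ℤ) = i' := by simpa using h
      exact_mod_cast this
    calc ∑ m ∈ S₂, f m ≤ ∑ m ∈ (Finset.range N).image (fun i : ℕ => c - i), f m :=
          Finset.sum_le_sum_of_subset_of_nonneg hsub fun m _ _ => hf0 m
      _ = ∑ i ∈ Finset.range N, f (c - i) := Finset.sum_image hinj
      _ = ∑ i ∈ Finset.range N, r ^ i := Finset.sum_congr rfl fun i _ => (hval i).2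
  calc ∑ m ∈ S, f m = ∑ m ∈ S₁, f m + ∑ m ∈ S₂, f m := (Finset.sum_filter_add_sum_filter_not S _ f).symm
    _ ≤ (1 - r)⁻¹ + (1 - r)⁻¹ := add_le_add (h1.trans hgeom) (h2.trans hgeom)
    _ ≤ (1 + a⁻¹) + (1 + a⁻¹) := add_le_add (inv_one_sub_exp_neg_le ha) (inv_one_sub_exp_neg_le ha)
    _ = 2 * (1 + a⁻¹) := by ring

/-- **Exponential sums on the infinite lattice are uniformly bounded**: for every finite `Λ ⊂ ℤ^{d+1}`, every `y` and `a > 0`,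
`Σ_{x∈Λ} e^{−a|y − x|₁} ≤ (2(1 + a⁻¹))^{d+1}`, uniformly in `Λ` (p. 427: *"we use it to make the summation over Δ(v′). We get some constant
O(1) depending on δ₁ and n̄ only"*; the torus version is p20 g2's `B3TorusRadialSums.sum_exp_neg_tdist_le`). [cite: Balaban1983Higgs3, (2.15) p.427] -/
theorem sum_exp_neg_dist₁_le {a : ℝ} (ha : 0 < a) (y : Fin (d + 1) → ℤ) (Λ : Finset (Fin (d + 1) → ℤ)) :
    ∑ x ∈ Λ, Real.exp (-(a * (dist₁ y x : ℝ))) ≤ (2 * (1 + a⁻¹)) ^ (d + 1) := by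
  classical
  -- the product structure of the summand
  set f : Fin (d + 1) → ℤ → ℝ := fun μ m => Real.exp (-(a * |((m - y μ : ℤ) : ℝ)|)) with hf
  have hf0 : ∀ μ m, 0 ≤ f μ m := fun μ m => (Real.exp_pos _).le
  have hprod : ∀ x : Fin (d + 1) → ℤ, Real.exp (-(a * (dist₁ y x : ℝ))) = ∏ μ : Fin (d + 1), f μ (x μ) := by
    intro x
    rw [← Real.exp_sum]
    congr 1
    simp only [dist₁]
    push_cast
    rw [Finset.mul_sum, ← Finset.sum_neg_distrib]
    refine Finset.sum_congr rfl fun μ _ => ?_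
    rw [Nat.cast_natAbs, Int.cast_abs, abs_sub_comm]
    push_cast
    ring
  -- `Λ` sits inside the product of its coordinate projections
  set t : Fin (d + 1) → Finset ℤ := fun μ => Λ.image (fun x => x μ) with ht
  have hsub : Λ ⊆ Fintype.piFinset t := fun x hx =>
    Fintype.mem_piFinset.2 fun μ => Finset.mem_image.2 ⟨x, hx, rfl⟩
  have hcoord : ∀ μ : Fin (d + 1), ∑ m ∈ t μ, f μ m ≤ 2 * (1 + a⁻¹) := fun μ => sum_exp_neg_abs_sub_le ha (y μ) (t μ)
  calc ∑ x ∈ Λ, Real.exp (-(a * (dist₁ y x : ℝ)))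
      = ∑ x ∈ Λ, ∏ μ : Fin (d + 1), f μ (x μ) := Finset.sum_congr rfl fun x _ => hprod x
    _ ≤ ∑ x ∈ Fintype.piFinset t, ∏ μ : Fin (d + 1), f μ (x μ) :=
        Finset.sum_le_sum_of_subset_of_nonneg hsub fun x _ _ => Finset.prod_nonneg fun μ _ => hf0 μ (x μ)
    _ = ∏ μ : Fin (d + 1), ∑ m ∈ t μ, f μ m := (Finset.prod_univ_sum t f).symm
    _ ≤ ∏ _μ : Fin (d + 1), (2 * (1 + a⁻¹)) :=
        Finset.prod_le_prod (fun μ _ => Finset.sum_nonneg fun m _ => hf0 μ m) fun μ _ => hcoord μ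
    _ = (2 * (1 + a⁻¹)) ^ (d + 1) := by rw [Finset.prod_const, Finset.card_univ, Fintype.card_fin]

/-- **The volume sum of half an exponential factor at scale `s`** on `ηℤ^{d+1}`: for `0 < η ≤ s`, `δ > 0`, every finite `Λ` and every `y`,
`Σ_{x∈Λ} η^{d+1}e^{−½δ(η|y−x|₁)/s} ≤ (2 + 4/δ)^{d+1}·s^{d+1}`, uniformly in `Λ` (twin of p20 g3's torus `B3AlphaGainSummed.sum_vol_exp_le`).
[cite: Balaban1983Higgs3, (2.15) p.427] -/
theorem sum_vol_exp_le {η s δ : ℝ} (hη : 0 < η) (hηs : η ≤ s) (hδ : 0 < δ) (y : Fin (d + 1) → ℤ)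
    (Λ : Finset (Fin (d + 1) → ℤ)) :
    ∑ x ∈ Λ, η ^ (d + 1) * Real.exp (-(δ / 2 * s⁻¹ * (η * dist₁ y x))) ≤ (2 + 4 / δ) ^ (d + 1) * s ^ (d + 1) := by
  have hs : 0 < s := lt_of_lt_of_le hη hηs
  set a : ℝ := δ / 2 * s⁻¹ * η with ha
  have ha0 : 0 < a := by positivity
  have hsum := sum_exp_neg_dist₁_le ha0 y Λ
  have hre : ∀ x : Fin (d + 1) → ℤ, Real.exp (-(δ / 2 * s⁻¹ * (η * dist₁ y x))) = Real.exp (-(a * (dist₁ y x : ℝ))) := by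
    intro x
    congr 1
    rw [ha]
    ring
  simp only [hre, ← Finset.mul_sum]
  have hainv : a⁻¹ = 2 * s / (δ * η) := by
    rw [ha]
    field_simp
  have hstep : η * (2 * (1 + a⁻¹)) ≤ (2 + 4 / δ) * s := by
    rw [hainv]
    have h1 : η * (2 * (1 + 2 * s / (δ * η))) = 2 * η + 4 * s / δ := by
      field_simp
      ring
    rw [h1]
    have h2 : (2 + 4 / δ) * s = 2 * s + 4 * s / δ := by ring
    rw [h2]
    linarith
  calc η ^ (d + 1) * ∑ x ∈ Λ, Real.exp (-(a * (dist₁ y x : ℝ)))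
      ≤ η ^ (d + 1) * (2 * (1 + a⁻¹)) ^ (d + 1) := mul_le_mul_of_nonneg_left hsum (by positivity)
    _ = (η * (2 * (1 + a⁻¹))) ^ (d + 1) := by rw [← mul_pow]
    _ ≤ ((2 + 4 / δ) * s) ^ (d + 1) := pow_le_pow_left₀ (by positivity) hstep _
    _ = (2 + 4 / δ) ^ (d + 1) * s ^ (d + 1) := by rw [mul_pow]

/-- kernel: **the three-point majorant summed on `ηℤ^{d+1}`** — for `f ≥ 0`, `0 < η ≤ s₁`, `η ≤ s₂` and all finite `Λ, Λ′, Λ″`,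
`Σ_{x∈Λ,x′∈Λ′,x″∈Λ″}η^{3(d+1)}f(x′)e^{−½δη|x−x′|₁/s₁}e^{−½δη|x′−x″|₁/s₂} ≤ (2 + 4/δ)^{d+1}s₁^{d+1}·(2 + 4/δ)^{d+1}s₂^{d+1}·Σ_{x′∈Λ′}η^{d+1}f(x′)`, UNIFORMLY
IN `Λ, Λ″`. [cite: Balaban1983Higgs3, (2.15) p.427] -/
theorem sum_majorant3Z_le {η s₁ s₂ δ : ℝ} (hη : 0 < η) (hηs₁ : η ≤ s₁) (hηs₂ : η ≤ s₂) (hδ : 0 < δ)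
    (f : (Fin (d + 1) → ℤ) → ℝ) (hf : ∀ x, 0 ≤ f x) (Λ Λ' Λ'' : Finset (Fin (d + 1) → ℤ)) :
    ∑ x ∈ Λ, ∑ x' ∈ Λ', ∑ x'' ∈ Λ'', η ^ (3 * (d + 1)) * (f x' *
        (Real.exp (-(δ / 2 * s₁⁻¹ * (η * dist₁ x x'))) * Real.exp (-(δ / 2 * s₂⁻¹ * (η * dist₁ x' x''))))) ≤
      ((2 + 4 / δ) ^ (d + 1) * s₁ ^ (d + 1)) * ((2 + 4 / δ) ^ (d + 1) * s₂ ^ (d + 1)) *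
        ∑ x' ∈ Λ', η ^ (d + 1) * f x' := by
  set C₁ : ℝ := (2 + 4 / δ) ^ (d + 1) * s₁ ^ (d + 1) with hC₁
  set C₂ : ℝ := (2 + 4 / δ) ^ (d + 1) * s₂ ^ (d + 1) with hC₂
  have hs₁ : 0 < s₁ := lt_of_lt_of_le hη hηs₁
  have hs₂ : 0 < s₂ := lt_of_lt_of_le hη hηs₂
  have hC₁0 : 0 ≤ C₁ := by positivity
  have hC₂0 : 0 ≤ C₂ := by positivity
  have h3d : η ^ (3 * (d + 1)) = η ^ (d + 1) * η ^ (d + 1) * η ^ (d + 1) := by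
    rw [show 3 * (d + 1) = (d + 1) + (d + 1) + (d + 1) by ring, pow_add, pow_add]
  -- the sums over x and x″ factor at fixed x′
  have hE1 : ∀ x' : Fin (d + 1) → ℤ, ∑ x ∈ Λ, η ^ (d + 1) * Real.exp (-(δ / 2 * s₁⁻¹ * (η * dist₁ x x'))) ≤ C₁ := by
    intro x'
    have h := sum_vol_exp_le hη hηs₁ hδ x' Λ
    simp only [dist₁_comm x'] at h
    exact h
  have hE2 : ∀ x' : Fin (d + 1) → ℤ, ∑ x'' ∈ Λ'', η ^ (d + 1) * Real.exp (-(δ / 2 * s₂⁻¹ * (η * dist₁ x' x''))) ≤ C₂ :=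
    fun x' => sum_vol_exp_le hη hηs₂ hδ x' Λ''
  rw [Finset.sum_comm]
  have hx' : ∀ x' : Fin (d + 1) → ℤ, ∑ x ∈ Λ, ∑ x'' ∈ Λ'', η ^ (3 * (d + 1)) * (f x' *
      (Real.exp (-(δ / 2 * s₁⁻¹ * (η * dist₁ x x'))) * Real.exp (-(δ / 2 * s₂⁻¹ * (η * dist₁ x' x''))))) ≤
      C₁ * C₂ * (η ^ (d + 1) * f x') := by
    intro x'
    have hre : ∑ x ∈ Λ, ∑ x'' ∈ Λ'', η ^ (3 * (d + 1)) * (f x' *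
        (Real.exp (-(δ / 2 * s₁⁻¹ * (η * dist₁ x x'))) * Real.exp (-(δ / 2 * s₂⁻¹ * (η * dist₁ x' x''))))) =
        η ^ (d + 1) * f x' * ((∑ x ∈ Λ, η ^ (d + 1) * Real.exp (-(δ / 2 * s₁⁻¹ * (η * dist₁ x x')))) *
          (∑ x'' ∈ Λ'', η ^ (d + 1) * Real.exp (-(δ / 2 * s₂⁻¹ * (η * dist₁ x' x''))))) := by
      rw [Finset.sum_mul_sum, Finset.mul_sum]
      refine Finset.sum_congr rfl fun x _ => ?_
      rw [Finset.mul_sum]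
      refine Finset.sum_congr rfl fun x'' _ => ?_
      rw [h3d]
      ring
    rw [hre]
    calc η ^ (d + 1) * f x' * ((∑ x ∈ Λ, η ^ (d + 1) * Real.exp (-(δ / 2 * s₁⁻¹ * (η * dist₁ x x')))) *
          (∑ x'' ∈ Λ'', η ^ (d + 1) * Real.exp (-(δ / 2 * s₂⁻¹ * (η * dist₁ x' x'')))))
        ≤ η ^ (d + 1) * f x' * (C₁ * C₂) :=
          mul_le_mul_of_nonneg_left (mul_le_mul (hE1 x') (hE2 x') (Finset.sum_nonneg fun x'' _ => by positivity) hC₁0)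
            (mul_nonneg (by positivity) (hf x'))
      _ = C₁ * C₂ * (η ^ (d + 1) * f x') := by ring
  calc ∑ x' ∈ Λ', ∑ x ∈ Λ, ∑ x'' ∈ Λ'', η ^ (3 * (d + 1)) * (f x' *
        (Real.exp (-(δ / 2 * s₁⁻¹ * (η * dist₁ x x'))) * Real.exp (-(δ / 2 * s₂⁻¹ * (η * dist₁ x' x'')))))
      ≤ ∑ x' ∈ Λ', C₁ * C₂ * (η ^ (d + 1) * f x') := Finset.sum_le_sum fun x' _ => hx' x'
    _ = C₁ * C₂ * ∑ x' ∈ Λ', η ^ (d + 1) * f x' := by rw [Finset.mul_sum]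

variable {W : Type*} [NormedAddCommGroup W] [InnerProductSpace ℝ W]

/-- **p. 444 [PDF 34]: *"This gives us a convergent expression"* — NORM FORM ON `ηℤ^{d+1}`, UNIFORM IN THE LOCALIZATION SETS `Λ, Λ″`:** under
the hypotheses of FILE 1's `abs_convergent334Z_le` (two-scale tree bound of `Γ` through `x′`, Hölder/sup bounds of the transported legs)
and `0 < η ≤ s₁`, `η ≤ s₂`, the two transported terms of (3.34) are bounded by
`(d+1)·K·(H₁B₂s₁^α + B₁H₂s₂^α)·(1 + 2/δ)·(2 + 4/δ)^{2(d+1)}s₁^{d+1}s₂^{d+1}·Σ_{x′∈Λ′}η^{d+1}‖φ′(x′)‖` — the sums over `x, x″` made with the exponential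
factors (p. 427), whatever the finite parts `Λ, Λ″` of the infinite lattice (twin of p20's torus `abs_convergent334_le_norm`).
[cite: Balaban1983Higgs3, (3.34) p.443; p.444] -/
theorem abs_convergent334Z_le_norm (η α : ℝ) (hη : 0 < η) {H₁ H₂ B₁ B₂ K δ s₁ s₂ : ℝ} (hα0 : 0 ≤ α) (hα1 : α ≤ 1)
    (hH₁ : 0 ≤ H₁) (hH₂ : 0 ≤ H₂) (hB₁ : 0 ≤ B₁) (hB₂ : 0 ≤ B₂) (hK : 0 ≤ K) (hδ : 0 < δ) (hηs₁ : η ≤ s₁) (hηs₂ : η ≤ s₂)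
    (Γ : Kernel3Z d W) (g : (Fin (d + 1) → ℤ) → ℝ) (A : Fin (d + 1) → (Fin (d + 1) → ℤ) → ℝ) (φ' φ'' : (Fin (d + 1) → ℤ) → W)
    (Λ Λ' Λ'' : Finset (Fin (d + 1) → ℤ))
    (hΓ : ∀ (μ : Fin (d + 1)), ∀ x ∈ Λ, ∀ x' ∈ Λ', ∀ x'' ∈ Λ'', ∀ (v : W), ‖Γ μ x x' x'' v‖ ≤
      K * Real.exp (-(δ * s₁⁻¹ * (η * dist₁ x x'))) * Real.exp (-(δ * s₂⁻¹ * (η * dist₁ x' x''))) * ‖v‖)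
    (hgAH : ∀ (μ : Fin (d + 1)), ∀ x ∈ Λ, ∀ x' ∈ Λ', |g x * A μ x - g x' * A μ x'| ≤ H₁ * (η * dist₁ x x') ^ α)
    (hgAB : ∀ (μ : Fin (d + 1)), ∀ x' ∈ Λ', |g x' * A μ x'| ≤ B₁)
    (hφ''H : ∀ x' ∈ Λ', ∀ x'' ∈ Λ'', ‖φ'' x'' - φ'' x'‖ ≤ H₂ * (η * dist₁ x' x'') ^ α)
    (hφ''B : ∀ x'' ∈ Λ'', ‖φ'' x''‖ ≤ B₂) :
    |tripleSumZ η Γ (fun μ x x' => (g x * A μ x - g x' * A μ x') / (η * dist₁ x x') ^ α) φ'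
          (fun x x' x'' => (η * dist₁ x x') ^ α • φ'' x'') Λ Λ' Λ'' +
        tripleSumZ η Γ (fun μ _ x' => g x' * A μ x') φ'
          (fun _ x' x'' => (η * dist₁ x'' x') ^ α • (((η * dist₁ x'' x') ^ α)⁻¹ • (φ'' x'' - φ'' x'))) Λ Λ' Λ''| ≤
      ((d + 1 : ℕ) : ℝ) * (K * (H₁ * B₂ * s₁ ^ α + B₁ * H₂ * s₂ ^ α) * (1 + 2 / δ)) *
        (((2 + 4 / δ) ^ (d + 1) * s₁ ^ (d + 1)) * ((2 + 4 / δ) ^ (d + 1) * s₂ ^ (d + 1))) *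
          ∑ x' ∈ Λ', η ^ (d + 1) * ‖φ' x'‖ := by
  have hs₁ : 0 < s₁ := lt_of_lt_of_le hη hηs₁
  have hs₂ : 0 < s₂ := lt_of_lt_of_le hη hηs₂
  have h1 := abs_convergent334Z_le η α hη hα0 hα1 hH₁ hH₂ hB₁ hB₂ hK hδ hs₁ hs₂ Γ g A φ' φ'' Λ Λ' Λ'' hΓ hgAH hgAB hφ''H hφ''B
  have h2 := sum_majorant3Z_le hη hηs₁ hηs₂ hδ (fun x' => ‖φ' x'‖) (fun x' => norm_nonneg _) Λ Λ' Λ''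
  have hc : 0 ≤ ((d + 1 : ℕ) : ℝ) * (K * (H₁ * B₂ * s₁ ^ α + B₁ * H₂ * s₂ ^ α) * (1 + 2 / δ)) := by positivity
  calc _ ≤ _ := h1
    _ ≤ ((d + 1 : ℕ) : ℝ) * (K * (H₁ * B₂ * s₁ ^ α + B₁ * H₂ * s₂ ^ α) * (1 + 2 / δ)) *
          ((((2 + 4 / δ) ^ (d + 1) * s₁ ^ (d + 1)) * ((2 + 4 / δ) ^ (d + 1) * s₂ ^ (d + 1))) *
            ∑ x' ∈ Λ', η ^ (d + 1) * ‖φ' x'‖) := mul_le_mul_of_nonneg_left h2 hc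
    _ = _ := by ring

/-- **p. 444 [PDF 34]: the remainder of the move of the localization functions — NORM FORM ON `ηℤ^{d+1}`, UNIFORM IN `Λ, Λ″`:** under the
hypotheses of FILE 1's `abs_local334Z_moveRemZ_le` and `0 < η ≤ s₁`, `η ≤ s₂`,
`|local334Z(moveRemZ g₁ g₃ Γ′)| ≤ (d+1)·K·B·(H₁B₃s₁^α + B₁H₃s₂^α)·(1 + 2/δ)·(2 + 4/δ)^{2(d+1)}s₁^{d+1}s₂^{d+1}·Σ_{x′∈Λ′}η^{d+1}‖φ′(x′)‖‖φ″(x′)‖`.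
[cite: Balaban1983Higgs3, (3.36) p.444] -/
theorem abs_local334Z_moveRemZ_le_norm (η : ℝ) (hη : 0 < η) {α K B H₁ B₁ H₃ B₃ δ s₁ s₂ : ℝ} (hα0 : 0 ≤ α) (hα1 : α ≤ 1)
    (hK : 0 ≤ K) (hB : 0 ≤ B) (hH₁ : 0 ≤ H₁) (hB₁ : 0 ≤ B₁) (hH₃ : 0 ≤ H₃) (hB₃ : 0 ≤ B₃) (hδ : 0 < δ) (hηs₁ : η ≤ s₁)
    (hηs₂ : η ≤ s₂) (Γ' : Kernel3Z d W) (g g₁ g₃ : (Fin (d + 1) → ℤ) → ℝ) (A : Fin (d + 1) → (Fin (d + 1) → ℤ) → ℝ)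
    (φ' φ'' : (Fin (d + 1) → ℤ) → W) (Λ Λ' Λ'' : Finset (Fin (d + 1) → ℤ))
    (hΓ : ∀ (μ : Fin (d + 1)), ∀ x ∈ Λ, ∀ x' ∈ Λ', ∀ x'' ∈ Λ'', ∀ (v : W), ‖Γ' μ x x' x'' v‖ ≤
      K * Real.exp (-(δ * s₁⁻¹ * (η * dist₁ x x'))) * Real.exp (-(δ * s₂⁻¹ * (η * dist₁ x' x''))) * ‖v‖)
    (hgA : ∀ (μ : Fin (d + 1)), ∀ x' ∈ Λ', |g x' * A μ x'| ≤ B)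
    (hg₁ : ∀ z z' : Fin (d + 1) → ℤ, |g₁ z - g₁ z'| ≤ H₁ * (η * dist₁ z z') ^ α) (hg₁b : ∀ z, |g₁ z| ≤ B₁)
    (hg₃ : ∀ z z' : Fin (d + 1) → ℤ, |g₃ z - g₃ z'| ≤ H₃ * (η * dist₁ z z') ^ α) (hg₃b : ∀ z, |g₃ z| ≤ B₃) :
    |local334Z η (moveRemZ g₁ g₃ Γ') g A φ' φ'' Λ Λ' Λ''| ≤
      ((d + 1 : ℕ) : ℝ) * (K * B * (H₁ * B₃ * s₁ ^ α + B₁ * H₃ * s₂ ^ α) * (1 + 2 / δ)) *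
        (((2 + 4 / δ) ^ (d + 1) * s₁ ^ (d + 1)) * ((2 + 4 / δ) ^ (d + 1) * s₂ ^ (d + 1))) *
          ∑ x' ∈ Λ', η ^ (d + 1) * (‖φ' x'‖ * ‖φ'' x'‖) := by
  have hs₁ : 0 < s₁ := lt_of_lt_of_le hη hηs₁
  have hs₂ : 0 < s₂ := lt_of_lt_of_le hη hηs₂
  have h1 := abs_local334Z_moveRemZ_le η hη hα0 hα1 hK hB hH₁ hB₁ hH₃ hB₃ hδ hs₁ hs₂ Γ' g g₁ g₃ A φ' φ'' Λ Λ' Λ'' hΓ hgA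
    hg₁ hg₁b hg₃ hg₃b
  have h2 := sum_majorant3Z_le hη hηs₁ hηs₂ hδ (fun x' => ‖φ' x'‖ * ‖φ'' x'‖) (fun x' => by positivity) Λ Λ' Λ''
  have hc : 0 ≤ ((d + 1 : ℕ) : ℝ) * (K * B * (H₁ * B₃ * s₁ ^ α + B₁ * H₃ * s₂ ^ α) * (1 + 2 / δ)) := by positivity
  have hre : ∑ x ∈ Λ, ∑ x' ∈ Λ', ∑ x'' ∈ Λ'', η ^ (3 * (d + 1)) * (‖φ' x'‖ * (‖φ'' x'‖ *
      (Real.exp (-(δ / 2 * s₁⁻¹ * (η * dist₁ x x'))) * Real.exp (-(δ / 2 * s₂⁻¹ * (η * dist₁ x' x'')))))) =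
      ∑ x ∈ Λ, ∑ x' ∈ Λ', ∑ x'' ∈ Λ'', η ^ (3 * (d + 1)) * (‖φ' x'‖ * ‖φ'' x'‖ *
      (Real.exp (-(δ / 2 * s₁⁻¹ * (η * dist₁ x x'))) * Real.exp (-(δ / 2 * s₂⁻¹ * (η * dist₁ x' x''))))) :=
    Finset.sum_congr rfl fun x _ => Finset.sum_congr rfl fun x' _ => Finset.sum_congr rfl fun x'' _ => by ring
  rw [hre] at h1
  calc _ ≤ _ := h1
    _ ≤ ((d + 1 : ℕ) : ℝ) * (K * B * (H₁ * B₃ * s₁ ^ α + B₁ * H₃ * s₂ ^ α) * (1 + 2 / δ)) *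
          ((((2 + 4 / δ) ^ (d + 1) * s₁ ^ (d + 1)) * ((2 + 4 / δ) ^ (d + 1) * s₂ ^ (d + 1))) *
            ∑ x' ∈ Λ', η ^ (d + 1) * (‖φ' x'‖ * ‖φ'' x'‖)) := mul_le_mul_of_nonneg_left h2 hc
    _ = _ := by ring

end VolumeSums

/-! ## §2 The kernel hypothesis DISCHARGED for triangle kernels of the (2.6)-pieces of `G_k(ηℤ^{d+1}, 0)` -/

section Pieces

variable {W : Type*} [NormedAddCommGroup W] [InnerProductSpace ℝ W]
variable {ℓ k : ℕ} {a m2 : ℝ}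

/-- kernel: a real power of a positive scale is positive. [folklore] -/
private theorem scaleZ_rpow_pos (ℓ k j : ℕ) (r : ℝ) : 0 < scaleZ ℓ k j ^ r := Real.rpow_pos_of_pos (scaleZ_pos ℓ k j) r

/-- **The two-scale tree bound through `x′` for the triangle kernel of the pieces of `G_k(0)`**: from (2.10) for the lattice pieces
(`(zeroLatticeKernelsH …).Ineq210 δ₁ C`, p26 g34), for the lines `G^η_{(j₁)}(0)` (`x–x′`), `G^η_{(j₂)}(0)` (`x′–x″`), `G^η_{(j₃)}(0)` (`x–x″`) and
a charge map with `‖T_μv‖ ≤ Q‖v‖`: `‖Γ′_μ(x,x′,x″)v‖ ≤ QC³(L^{j₁}η)^{2−(d+1)}(L^{j₂}η)^{2−(d+1)}(L^{j₃}η)^{2−(d+1)}e^{−δ′η|x−x′|₁/L^{j₁}η}e^{−δ′η|x′−x″|₁/L^{j₂}η}‖v‖`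
for every rate `0 ≤ δ′ ≤ δ₁/(d+1)` (the decay of the third line is dropped). [cite: Balaban1983Higgs3, (2.10) p.426, (3.36) p.444] -/
theorem norm_triKernelZ_gpieceZ_le (hℓ : 1 ≤ ℓ) {δ₁ C : ℝ} (hC : 0 ≤ C)
    (h210 : (zeroLatticeKernelsH d ℓ k hℓ a m2).Ineq210 δ₁ C) {δ' : ℝ} (hδ'0 : 0 ≤ δ') (hδ' : δ' ≤ δ₁ / ((d + 1 : ℕ) : ℝ))
    {Q : ℝ} (T : Fin (d + 1) → W →ₗ[ℝ] W) (hT : ∀ (μ : Fin (d + 1)) (v : W), ‖T μ v‖ ≤ Q * ‖v‖) (j₁ j₂ j₃ : ℕ)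
    (μ : Fin (d + 1)) (x x' x'' : Fin (d + 1) → ℤ) (v : W) :
    ‖triKernelZ T (gpieceZ ℓ k j₁ a m2) (gpieceZ ℓ k j₂ a m2) (gpieceZ ℓ k j₃ a m2) μ x x' x'' v‖ ≤
      Q * (C * scaleZ ℓ k j₁ ^ (2 - ((d + 1 : ℕ) : ℝ))) * (C * scaleZ ℓ k j₂ ^ (2 - ((d + 1 : ℕ) : ℝ))) *
          (C * scaleZ ℓ k j₃ ^ (2 - ((d + 1 : ℕ) : ℝ))) *
        Real.exp (-(δ' * (scaleZ ℓ k j₁)⁻¹ * (etaZ ℓ k * dist₁ x x'))) *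
        Real.exp (-(δ' * (scaleZ ℓ k j₂)⁻¹ * (etaZ ℓ k * dist₁ x' x''))) * ‖v‖ := by
  have h1 := abs_gpieceZ_le hℓ h210 hδ'0 hδ' j₁ x x'
  have h2 := abs_gpieceZ_le hℓ h210 hδ'0 hδ' j₂ x' x''
  have h3 : |gpieceZ ℓ k j₃ a m2 x x''| ≤ C * scaleZ ℓ k j₃ ^ (2 - ((d + 1 : ℕ) : ℝ)) := by
    refine (abs_gpieceZ_le hℓ h210 hδ'0 hδ' j₃ x x'').trans ?_
    have hE : Real.exp (-(δ' * (scaleZ ℓ k j₃)⁻¹ * (etaZ ℓ k * dist₁ x x''))) ≤ 1 := by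
      rw [Real.exp_le_one_iff, neg_nonpos]
      have := scaleZ_pos ℓ k j₃
      have := etaZ_pos ℓ k
      positivity
    have hc : 0 ≤ C * scaleZ ℓ k j₃ ^ (2 - ((d + 1 : ℕ) : ℝ)) := mul_nonneg hC (scaleZ_rpow_pos ℓ k j₃ _).le
    calc C * scaleZ ℓ k j₃ ^ (2 - ((d + 1 : ℕ) : ℝ)) * Real.exp (-(δ' * (scaleZ ℓ k j₃)⁻¹ * (etaZ ℓ k * dist₁ x x'')))
        ≤ C * scaleZ ℓ k j₃ ^ (2 - ((d + 1 : ℕ) : ℝ)) * 1 := mul_le_mul_of_nonneg_left hE hc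
      _ = _ := mul_one _
  exact norm_triKernelZ_le (mul_nonneg hC (scaleZ_rpow_pos ℓ k j₁ _).le) (mul_nonneg hC (scaleZ_rpow_pos ℓ k j₂ _).le)
    (mul_nonneg hC (scaleZ_rpow_pos ℓ k j₃ _).le) T _ _ _ hT h1 h2 h3 μ v

/-- **p. 444: *"This gives us a convergent expression"* FOR THE PIECES OF THE PRINT'S OWN §3 PROPAGATOR `G_k(0) = G_k(ηℤ^{d+1}, 0)` —
the two transported terms of (3.34) with NO kernel hypothesis.**  For `d`, `L = ℓ + 1 ≥ 2` and a window `[a₋,a₊] × [0,m²₊]` (`a₋ > 0`)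
there are `δ, C > 0` such that for EVERY scale `k ≥ 1`, every window point, all piece indices `j₁, j₂, j₃` (the three lines of the
triangle kernel `Γ = K₁(x,x′)K₂(x′,x″)K₃(x,x″)·T_μ` are the zero-field pieces `G^η_{(j₁)}(0)`, `G^η_{(j₂)}(0)`, `G^η_{(j₃)}(0)`), every charge
map with `‖T_μv‖ ≤ Q‖v‖`, every `0 ≤ α ≤ 1`, all legs with the Hölder/sup bounds `H₁, B₁` (`gA`), `H₂, B₂` (`φ″`) and all finite localization
sets: the two transported terms are at most `(d+1)·QC³(L^{j₁}η)^{2−(d+1)}(L^{j₂}η)^{2−(d+1)}(L^{j₃}η)^{2−(d+1)}·(H₁B₂(L^{j₁}η)^α + B₁H₂(L^{j₂}η)^α)·(1 + 2/δ)`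
times the degree-0 majorant `Σ η^{3(d+1)}‖φ′(x′)‖e^{−½δη|x−x′|₁/L^{j₁}η}e^{−½δη|x′−x″|₁/L^{j₂}η}` — the (2.10) inputs are p26 g34's lattice pieces
(`B3Ineq211ZeroLattice.ineq210_zeroLatticeH`), rate `δ = δ₁/(d+1)`. [cite: Balaban1983Higgs3, (3.34) p.443; p.444; (2.10) p.426] -/
theorem abs_convergent334Z_le_zeroLattice (d ℓ : ℕ) (hℓ : 1 ≤ ℓ) (amin aplus m2plus : ℝ) (ha : 0 < amin)
    {W : Type*} [NormedAddCommGroup W] [InnerProductSpace ℝ W] :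
    ∃ δ C : ℝ, 0 < δ ∧ 0 < C ∧ ∀ (k : ℕ), 1 ≤ k → ∀ (a m2 : ℝ), amin ≤ a → a ≤ aplus → 0 ≤ m2 → m2 ≤ m2plus →
      ∀ (j₁ j₂ j₃ : ℕ) {α H₁ H₂ B₁ B₂ Q : ℝ}, 0 ≤ α → α ≤ 1 → 0 ≤ H₁ → 0 ≤ H₂ → 0 ≤ B₁ → 0 ≤ B₂ → 0 ≤ Q →
      ∀ (T : Fin (d + 1) → W →ₗ[ℝ] W), (∀ (μ : Fin (d + 1)) (v : W), ‖T μ v‖ ≤ Q * ‖v‖) →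
      ∀ (g : (Fin (d + 1) → ℤ) → ℝ) (A : Fin (d + 1) → (Fin (d + 1) → ℤ) → ℝ) (φ' φ'' : (Fin (d + 1) → ℤ) → W)
        (Λ Λ' Λ'' : Finset (Fin (d + 1) → ℤ)),
      (∀ (μ : Fin (d + 1)), ∀ x ∈ Λ, ∀ x' ∈ Λ', |g x * A μ x - g x' * A μ x'| ≤ H₁ * (etaZ ℓ k * dist₁ x x') ^ α) →
      (∀ (μ : Fin (d + 1)), ∀ x' ∈ Λ', |g x' * A μ x'| ≤ B₁) →
      (∀ x' ∈ Λ', ∀ x'' ∈ Λ'', ‖φ'' x'' - φ'' x'‖ ≤ H₂ * (etaZ ℓ k * dist₁ x' x'') ^ α) →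
      (∀ x'' ∈ Λ'', ‖φ'' x''‖ ≤ B₂) →
        |tripleSumZ (etaZ ℓ k)
              (triKernelZ T (gpieceZ ℓ k j₁ a m2) (gpieceZ ℓ k j₂ a m2) (gpieceZ ℓ k j₃ a m2))
              (fun μ x x' => (g x * A μ x - g x' * A μ x') / (etaZ ℓ k * dist₁ x x') ^ α) φ'
              (fun x x' x'' => (etaZ ℓ k * dist₁ x x') ^ α • φ'' x'') Λ Λ' Λ'' +
            tripleSumZ (etaZ ℓ k)
              (triKernelZ T (gpieceZ ℓ k j₁ a m2) (gpieceZ ℓ k j₂ a m2) (gpieceZ ℓ k j₃ a m2))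
              (fun μ _ x' => g x' * A μ x') φ'
              (fun _ x' x'' => (etaZ ℓ k * dist₁ x'' x') ^ α •
                (((etaZ ℓ k * dist₁ x'' x') ^ α)⁻¹ • (φ'' x'' - φ'' x'))) Λ Λ' Λ''| ≤
          ((d + 1 : ℕ) : ℝ) *
            ((Q * (C * scaleZ ℓ k j₁ ^ (2 - ((d + 1 : ℕ) : ℝ))) * (C * scaleZ ℓ k j₂ ^ (2 - ((d + 1 : ℕ) : ℝ))) *
                (C * scaleZ ℓ k j₃ ^ (2 - ((d + 1 : ℕ) : ℝ)))) *
              (H₁ * B₂ * scaleZ ℓ k j₁ ^ α + B₁ * H₂ * scaleZ ℓ k j₂ ^ α) * (1 + 2 / δ)) *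
            ∑ x ∈ Λ, ∑ x' ∈ Λ', ∑ x'' ∈ Λ'', etaZ ℓ k ^ (3 * (d + 1)) * (‖φ' x'‖ *
              (Real.exp (-(δ / 2 * (scaleZ ℓ k j₁)⁻¹ * (etaZ ℓ k * dist₁ x x'))) *
                Real.exp (-(δ / 2 * (scaleZ ℓ k j₂)⁻¹ * (etaZ ℓ k * dist₁ x' x''))))) := by
  obtain ⟨δ₁, C, hδ₁, hC, h210⟩ := ineq210_zeroLatticeH d ℓ hℓ amin aplus m2plus ha
  have hd1 : (0 : ℝ) < ((d + 1 : ℕ) : ℝ) := by positivity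
  refine ⟨δ₁ / ((d + 1 : ℕ) : ℝ), C, div_pos hδ₁ hd1, hC, ?_⟩
  intro k hk a m2 h1 h2 h3 h4 j₁ j₂ j₃ α H₁ H₂ B₁ B₂ Q hα0 hα1 hH₁ hH₂ hB₁ hB₂ hQ T hT g A φ' φ'' Λ Λ' Λ'' hgAH hgAB hφ''H hφ''B
  have h210k := h210 k hk a m2 h1 h2 h3 h4
  have hδ'0 : 0 ≤ δ₁ / ((d + 1 : ℕ) : ℝ) := (div_pos hδ₁ hd1).le
  have hKnn : 0 ≤ Q * (C * scaleZ ℓ k j₁ ^ (2 - ((d + 1 : ℕ) : ℝ))) * (C * scaleZ ℓ k j₂ ^ (2 - ((d + 1 : ℕ) : ℝ))) *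
      (C * scaleZ ℓ k j₃ ^ (2 - ((d + 1 : ℕ) : ℝ))) :=
    mul_nonneg (mul_nonneg (mul_nonneg hQ (mul_nonneg hC.le (scaleZ_rpow_pos ℓ k j₁ _).le))
      (mul_nonneg hC.le (scaleZ_rpow_pos ℓ k j₂ _).le)) (mul_nonneg hC.le (scaleZ_rpow_pos ℓ k j₃ _).le)
  exact abs_convergent334Z_le (etaZ ℓ k) α (etaZ_pos ℓ k) hα0 hα1 hH₁ hH₂ hB₁ hB₂ hKnn (div_pos hδ₁ hd1) (scaleZ_pos ℓ k j₁)
    (scaleZ_pos ℓ k j₂) _ g A φ' φ'' Λ Λ' Λ''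
    (fun μ x _ x' _ x'' _ v => norm_triKernelZ_gpieceZ_le hℓ hC.le h210k hδ'0 le_rfl T hT j₁ j₂ j₃ μ x x' x'' v)
    hgAH hgAB hφ''H hφ''B

/-- **p. 444: the remainder of the move of the localization functions FOR THE PIECES OF `G_k(ηℤ^{d+1}, 0)` — `abs_local334Z_moveRemZ_le`
with NO kernel hypothesis**, same quantifier structure and constants as `abs_convergent334Z_le_zeroLattice` (legs: `|gA_μ| ≤ B` on `Λ′`,
localization functions `g₁` (vertex `x`), `g₃` (vertex `x″`) with Hölder constants `H₁, H₃` and sup bounds `B₁, B₃`).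
[cite: Balaban1983Higgs3, (3.36) p.444, (2.10) p.426] -/
theorem abs_local334Z_moveRemZ_le_zeroLattice (d ℓ : ℕ) (hℓ : 1 ≤ ℓ) (amin aplus m2plus : ℝ) (ha : 0 < amin)
    {W : Type*} [NormedAddCommGroup W] [InnerProductSpace ℝ W] :
    ∃ δ C : ℝ, 0 < δ ∧ 0 < C ∧ ∀ (k : ℕ), 1 ≤ k → ∀ (a m2 : ℝ), amin ≤ a → a ≤ aplus → 0 ≤ m2 → m2 ≤ m2plus →
      ∀ (j₁ j₂ j₃ : ℕ) {α B H₁ B₁ H₃ B₃ Q : ℝ}, 0 ≤ α → α ≤ 1 → 0 ≤ B → 0 ≤ H₁ → 0 ≤ B₁ → 0 ≤ H₃ → 0 ≤ B₃ → 0 ≤ Q →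
      ∀ (T : Fin (d + 1) → W →ₗ[ℝ] W), (∀ (μ : Fin (d + 1)) (v : W), ‖T μ v‖ ≤ Q * ‖v‖) →
      ∀ (g g₁ g₃ : (Fin (d + 1) → ℤ) → ℝ) (A : Fin (d + 1) → (Fin (d + 1) → ℤ) → ℝ) (φ' φ'' : (Fin (d + 1) → ℤ) → W)
        (Λ Λ' Λ'' : Finset (Fin (d + 1) → ℤ)),
      (∀ (μ : Fin (d + 1)), ∀ x' ∈ Λ', |g x' * A μ x'| ≤ B) →
      (∀ z z' : Fin (d + 1) → ℤ, |g₁ z - g₁ z'| ≤ H₁ * (etaZ ℓ k * dist₁ z z') ^ α) → (∀ z, |g₁ z| ≤ B₁) →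
      (∀ z z' : Fin (d + 1) → ℤ, |g₃ z - g₃ z'| ≤ H₃ * (etaZ ℓ k * dist₁ z z') ^ α) → (∀ z, |g₃ z| ≤ B₃) →
        |local334Z (etaZ ℓ k)
            (moveRemZ g₁ g₃ (triKernelZ T (gpieceZ ℓ k j₁ a m2) (gpieceZ ℓ k j₂ a m2) (gpieceZ ℓ k j₃ a m2)))
            g A φ' φ'' Λ Λ' Λ''| ≤
          ((d + 1 : ℕ) : ℝ) *
            ((Q * (C * scaleZ ℓ k j₁ ^ (2 - ((d + 1 : ℕ) : ℝ))) * (C * scaleZ ℓ k j₂ ^ (2 - ((d + 1 : ℕ) : ℝ))) *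
                (C * scaleZ ℓ k j₃ ^ (2 - ((d + 1 : ℕ) : ℝ)))) * B *
              (H₁ * B₃ * scaleZ ℓ k j₁ ^ α + B₁ * H₃ * scaleZ ℓ k j₂ ^ α) * (1 + 2 / δ)) *
            ∑ x ∈ Λ, ∑ x' ∈ Λ', ∑ x'' ∈ Λ'', etaZ ℓ k ^ (3 * (d + 1)) * (‖φ' x'‖ * (‖φ'' x'‖ *
              (Real.exp (-(δ / 2 * (scaleZ ℓ k j₁)⁻¹ * (etaZ ℓ k * dist₁ x x'))) *
                Real.exp (-(δ / 2 * (scaleZ ℓ k j₂)⁻¹ * (etaZ ℓ k * dist₁ x' x'')))))) := by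
  obtain ⟨δ₁, C, hδ₁, hC, h210⟩ := ineq210_zeroLatticeH d ℓ hℓ amin aplus m2plus ha
  have hd1 : (0 : ℝ) < ((d + 1 : ℕ) : ℝ) := by positivity
  refine ⟨δ₁ / ((d + 1 : ℕ) : ℝ), C, div_pos hδ₁ hd1, hC, ?_⟩
  intro k hk a m2 h1 h2 h3 h4 j₁ j₂ j₃ α B H₁ B₁ H₃ B₃ Q hα0 hα1 hB hH₁ hB₁ hH₃ hB₃ hQ T hT g g₁ g₃ A φ' φ'' Λ Λ' Λ'' hgA hg₁ hg₁b
    hg₃ hg₃b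
  have h210k := h210 k hk a m2 h1 h2 h3 h4
  have hδ'0 : 0 ≤ δ₁ / ((d + 1 : ℕ) : ℝ) := (div_pos hδ₁ hd1).le
  have hKnn : 0 ≤ Q * (C * scaleZ ℓ k j₁ ^ (2 - ((d + 1 : ℕ) : ℝ))) * (C * scaleZ ℓ k j₂ ^ (2 - ((d + 1 : ℕ) : ℝ))) *
      (C * scaleZ ℓ k j₃ ^ (2 - ((d + 1 : ℕ) : ℝ))) :=
    mul_nonneg (mul_nonneg (mul_nonneg hQ (mul_nonneg hC.le (scaleZ_rpow_pos ℓ k j₁ _).le))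
      (mul_nonneg hC.le (scaleZ_rpow_pos ℓ k j₂ _).le)) (mul_nonneg hC.le (scaleZ_rpow_pos ℓ k j₃ _).le)
  exact abs_local334Z_moveRemZ_le (etaZ ℓ k) (etaZ_pos ℓ k) hα0 hα1 hKnn hB hH₁ hB₁ hH₃ hB₃ (div_pos hδ₁ hd1)
    (scaleZ_pos ℓ k j₁) (scaleZ_pos ℓ k j₂) _ g g₁ g₃ A φ' φ'' Λ Λ' Λ''
    (fun μ x _ x' _ x'' _ v => norm_triKernelZ_gpieceZ_le hℓ hC.le h210k hδ'0 le_rfl T hT j₁ j₂ j₃ μ x x' x'' v)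
    hgA hg₁ hg₁b hg₃ hg₃b

end Pieces

/-! ## §3 *"we sum the expressions (3.36) over admissible orderings and indices and we get the expressions of the same type but with
propagators G^η_{j₀}(0), G^η_{j₀}"* — at the pieces of `G_k(ηℤ^{d+1}, 0)` -/

section Resum

variable {W : Type*} [NormedAddCommGroup W] [InnerProductSpace ℝ W]
variable {ℓ k : ℕ} {a m2 : ℝ}

/-- (2.6) for the resummed lattice propagator, in the `B3.Display26` shape: `𝒢_n = Σ_{j<n} G^η_{(j)}(0)` (p26's `sum_gpieceZ_range`).
[cite: Balaban1983Higgs3, (2.6) p.424, (3.36) p.444] -/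
theorem display26_GresumZ {n : ℕ} (hn : 1 ≤ n) (hnk : n ≤ k) :
    B3.Display26 (GresumZ (d := d) ℓ k n a m2) (fun j => gpieceZ ℓ k j a m2) n :=
  (sum_gpieceZ_range hn hnk).symm

/-- **p. 444 [PDF 34] FOR THE PIECES OF `G_k(0)` ON `ηℤ^{d+1}`**: summing (3.36) with the triangle kernel
`G^η_{(j₁)}(0)(x,x′)G^η_{(j₂)}(0)(x′,x″)G^η_{(j₃)}(0)(x,x″)·T_μ` over the indices `j₁, j₂, j₃ < n` of the three internal lines gives (3.36) with the
resummed propagator `𝒢_n = Σ_{j<n}G^η_{(j)}(0)` in all three lines (`1 ≤ n ≤ k`; `𝒢_k = G_k(0)`, p26's `GresumZ_top`) — *"the expressions of the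
same type but with propagators G^η_{j₀}(0), G^η_{j₀}"* (the print's `n = j₀` in its index convention; on the `η`-lattice `𝒢_n` is the reading
`GetaL` of the `n`-th-step propagator by p39 g17's `B3GscaleLatRescaling.GresumZ_eq_GetaL`). [cite: Balaban1983Higgs3, (3.36) p.444] -/
theorem local336Z_triKernelZ_resum_zeroLattice {n : ℕ} (hn : 1 ≤ n) (hnk : n ≤ k) (T : Fin (d + 1) → W →ₗ[ℝ] W)
    (locs : (Fin (d + 1) → ℤ) → ℝ) (A : Fin (d + 1) → (Fin (d + 1) → ℤ) → ℝ) (φ' φ'' : (Fin (d + 1) → ℤ) → W)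
    (Λ Λ' Λ'' : Finset (Fin (d + 1) → ℤ)) :
    ∑ j₁ ∈ Finset.range n, ∑ j₂ ∈ Finset.range n, ∑ j₃ ∈ Finset.range n,
        local336Z (etaZ ℓ k) (triKernelZ T (gpieceZ ℓ k j₁ a m2) (gpieceZ ℓ k j₂ a m2) (gpieceZ ℓ k j₃ a m2))
          locs A φ' φ'' Λ Λ' Λ'' =
      local336Z (etaZ ℓ k) (triKernelZ T (GresumZ ℓ k n a m2) (GresumZ ℓ k n a m2) (GresumZ ℓ k n a m2))
        locs A φ' φ'' Λ Λ' Λ'' :=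
  local336Z_triKernelZ_resum (etaZ ℓ k) T (display26_GresumZ hn hnk) (display26_GresumZ hn hnk) (display26_GresumZ hn hnk)
    locs A φ' φ'' Λ Λ' Λ''

end Resum

end

end Literature.MathematicalPhysics.QuantumFieldTheory.Balaban1983to89.B3Eq334ZeroLatticePieces
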